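import Literature.AlgebraicGeometry.Resolution.MonomializationAlongValuation
import Literature.AlgebraicGeometry.Resolution.ArithmeticalThreefoldsLocalEtaleClimb
import Literature.RingTheory.KrullDimension.AffineDimension
import Mathlib.FieldTheory.IsAlgClosed.Basic
import HarnessLib

/-!
# The Kummer covering of a monomialized local uniformization

Topic: `Literature/AlgebraicGeometry/Resolution`. PROOF side of `CossartPiltant2019ReductionP`
(`ArithmeticalThreefoldsLocal.lean`), towards input (C3) of
`cossartPiltant2019ReductionP_of_cjs_of_parts` — tame ascent along a Galois step of prime degree
`ℓ ≠ p`, [CoP1] Prop. 6.3 (HAL Prop. 8.3 (2)). The source resolves the hypersurface `X^ℓ − f`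
over a model in which `f` has been monomialized, by the Perron transforms of its Lemma 8.2 along
a rank-two valuation. This tree takes a shorter road (same input — monomialization of `f` by
embedded resolution, `MonomializationAlongValuation.lean` — different output): once
`f = u ∏ zᵢ^{αᵢ}` in a regular local model with regular parameters `zᵢ` and a unit `u`, the
covering obtained by adjoining `ℓ`-th roots of ALL the `zᵢ` and of `u` is regular for free
(Kummer in the parameters, local-étale in the unit, as in the proof of [CoP1] Lemma 9.4, HAL
p. 29), and it contains an `ℓ`-th root of `f`; the way back down is then a TAME DESCENT (input
(C4), [CoP1] Prop. 9.3), as the covering is abelian of exponent `ℓ` prime to `p`.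

* `isRegularLocalRing_localization_adjoin_roots` — PROVED: `R′[z₁^{1/ℓ}, …, z_d^{1/ℓ}]` is
  regular at the centre of the valuation, with the roots as regular parameters;
* `exists_model_adjoin_roots_of_monomial` — PROVED, frame version: from a local uniformization
  of a subfield `M` and `0 ≠ x ∈ 𝔪_v` in its local ring, elements `ρ₀, …, ρ_d` with `ρⱼ^ℓ ∈ M`,
  `x = ∏ ρⱼ^{ℓ eⱼ}`, and a local uniformization of `M(ρ)` (embedded resolution entering as the
  hypothesis `hEmb`, the statement of Cossart–Jannsen–Saito 2020, Cor. 1.5).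

Everything is PROVED; no named facts are introduced.

## Sources

* V. Cossart, O. Piltant, J. Algebra 320 (2008) 1051–1082, Prop. 6.3 and Lemma 9.4's proof
  (HAL hal-00139124: Prop. 8.3 pp. 23–26, Lemma 9.4 pp. 28–29). [CossartPiltant2008]
* V. Cossart, U. Jannsen, S. Saito, LNM 2270 (2020), Cor. 1.5, p. 7. [CossartJannsenSaito2020]
* V. Cossart, O. Piltant, J. Algebra 529 (2019), proof of Prop. 4.10 (arXiv v1 Prop. 4.8,
  pp. 53–54). [CossartPiltant2019]
-/

noncomputable section

open CategoryTheory AlgebraicGeometry TopologicalSpace IsLocalRing _root_.Polynomial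

namespace Literature.AlgebraicGeometry.Resolution

universe u

/-- Elements of the subfield generated by `S` and `t` are fractions of elements of `S[t]`.
[folklore] -/
private theorem exists_div_eq_of_mem_closure_aux' {S Ω : Type u} [CommRing S] [Field Ω]
    [Algebra S Ω] (t : Set Ω) {z : Ω}
    (hz : z ∈ Subfield.closure (Set.range (algebraMap S Ω) ∪ t)) :
    ∃ a b : Ω, a ∈ Algebra.adjoin S t ∧ b ∈ Algebra.adjoin S t ∧ b ≠ 0 ∧ z = a / b := by
  obtain ⟨y, hy, w, hw, hyw⟩ := Subfield.mem_closure_iff.mp hz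
  rw [← Algebra.adjoin_eq_ring_closure] at hy hw
  by_cases hw0 : w = 0
  · refine ⟨0, 1, zero_mem _, one_mem _, one_ne_zero, ?_⟩
    rw [← hyw, hw0, div_zero, zero_div]
  · exact ⟨y, w, hy, hw, hw0, hyw.symm⟩

/-! ## Adjoining roots of a regular system of parameters -/

section Roots

variable {R' E : Type u} [CommRing R'] [IsRegularLocalRing R'] [Field E] [Algebra R' E]
  (OE : ValuationSubring E)

/-- **Adjoining `ℓ`-th roots of a regular system of parameters keeps a regular local ring
regular** (the model upstairs in the Kummer covering `xᵢ = yᵢ^ℓ`; cf. [CoP1] proof of Lemma 9.4,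
"`S₁ := S̄_{𝔪_W ∩ S̄}` is a local model of `W` and `S₁` is regular", HAL p. 29). Let `R′` be a
regular local ring mapped injectively into a field `E` and dominated by a valuation ring `O_E`
(`r ∈ 𝔪 ⇔ v(r) > 0`), `z₁,…,z_d` a regular system of parameters (`d = dim R′` generators of `𝔪`)
and `yᵢ ∈ E` with `yᵢ^ℓ = zᵢ`, `ℓ ≥ 1`. Then for `B := R′[y₁,…,y_d] ⊆ E` and its centre
`Q = {v > 0}`: `Q = (y₁,…,y_d)` (an element of `B` is a polynomial in the `yᵢ` over `R′`, and lies
in `Q` iff its constant coefficient lies in `𝔪 = (z) = (y^ℓ)`), `B` is integral over `R′` and local,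
`dim B_Q = dim B = dim R′ = d`, so `B_Q` is regular with regular system of parameters `y`.
[cite: CossartPiltant2008, proof of Lemma 9.4 (HAL p. 29)] -/
theorem isRegularLocalRing_localization_adjoin_roots
    (hinj : Function.Injective (algebraMap R' E)) (hRO : ∀ r : R', algebraMap R' E r ∈ OE)
    (hRm : ∀ r : R', r ∈ maximalIdeal R' ↔ OE.valuation (algebraMap R' E r) < 1)
    {d : ℕ} (z : Fin d → R') (hspan : Ideal.span (Set.range z) = maximalIdeal R')
    (hdim : ringKrullDim R' = d) {ℓ : ℕ} (hℓ : 0 < ℓ) (y : Fin d → E)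
    (hy : ∀ i, y i ^ ℓ = algebraMap R' E (z i))
    (Q : Ideal (Algebra.adjoin R' (Set.range y))) [Q.IsPrime]
    (hQ : ∀ b : Algebra.adjoin R' (Set.range y), b ∈ Q ↔ OE.valuation (b : E) < 1) :
    IsRegularLocalRing (Localization.AtPrime Q) ∧ ringKrullDim (Localization.AtPrime Q) = d ∧
      Ideal.span (Set.range fun i => algebraMap (Algebra.adjoin R' (Set.range y))
        (Localization.AtPrime Q) ⟨y i, Algebra.subset_adjoin ⟨i, rfl⟩⟩) = maximalIdeal _ := by
  classical
  haveI : IsDomain R' := isDomain_of_isRegularLocalRing R'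
  let B : Subalgebra R' E := Algebra.adjoin R' (Set.range y)
  let yB : Fin d → B := fun i => ⟨y i, Algebra.subset_adjoin ⟨i, rfl⟩⟩
  have hℓ0 : ℓ ≠ 0 := hℓ.ne'
  -- values
  have hvalR : ∀ r : R', OE.valuation (algebraMap R' E r) ≤ 1 := fun r =>
    (OE.valuation_le_one_iff _).mpr (hRO r)
  have hzm : ∀ i, z i ∈ maximalIdeal R' := fun i => hspan ▸ Ideal.subset_span ⟨i, rfl⟩
  have hvz : ∀ i, OE.valuation (algebraMap R' E (z i)) < 1 := fun i => (hRm _).mp (hzm i)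
  have hvy : ∀ i, OE.valuation (y i) < 1 := fun i => by
    by_contra h
    have h1 : 1 ≤ OE.valuation (y i) := not_lt.mp h
    have h2 : 1 ≤ OE.valuation (y i ^ ℓ) := by
      rw [map_pow]
      exact one_le_pow₀ h1
    rw [hy i] at h2
    exact not_lt.mpr h2 (hvz i)
  have hyO : ∀ i, y i ∈ OE := fun i => (OE.valuation_le_one_iff _).mp (hvy i).le
  have hBO : ∀ b : B, (b : E) ∈ OE := by
    intro b
    refine Algebra.adjoin_induction (p := fun b _ => b ∈ OE) ?_ ?_ ?_ ?_ b.2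
    · rintro _ ⟨i, rfl⟩; exact hyO i
    · exact hRO
    · exact fun _ _ _ _ => OE.add_mem _ _
    · exact fun _ _ _ _ => OE.mul_mem _ _
  have hyQ : ∀ i, yB i ∈ Q := fun i => (hQ _).mpr (hvy i)
  -- `algebraMap R' B` and its compatibility
  have halgB : ∀ r : R', ((algebraMap R' B r : B) : E) = algebraMap R' E r := fun _ => rfl
  have hcomapQ : Q.comap (algebraMap R' B) = maximalIdeal R' := by
    ext r
    rw [Ideal.mem_comap, hQ, halgB, hRm]
  -- `Q = (y₁, …, y_d)`
  let J : Ideal B := Ideal.span (Set.range yB)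
  have hJQ : J ≤ Q := by
    rw [Ideal.span_le]
    rintro _ ⟨i, rfl⟩
    exact hyQ i
  have hzJ : ∀ i, algebraMap R' B (z i) ∈ J := fun i => by
    have h1 : algebraMap R' B (z i) = yB i ^ ℓ := Subtype.ext (by
      rw [halgB, ← hy i]; rfl)
    rw [h1]
    exact Ideal.pow_mem_of_mem J (Ideal.subset_span (Set.mem_range_self i)) ℓ hℓ
  have hmJ : ∀ c ∈ maximalIdeal R', algebraMap R' B c ∈ J := by
    intro c hc
    rw [← hspan] at hc
    refine Submodule.span_induction (p := fun c _ => algebraMap R' B c ∈ J) ?_ ?_ ?_ ?_ hc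
    · rintro _ ⟨i, rfl⟩; exact hzJ i
    · rw [map_zero]; exact J.zero_mem
    · intro a b _ _ ha hb; rw [map_add]; exact J.add_mem ha hb
    · intro a b _ hb; rw [smul_eq_mul, map_mul]; exact J.mul_mem_left _ hb
  -- every element of `B` is a polynomial in `y` over `R'`
  have haeval : ∀ p : MvPolynomial (Fin d) R',
      MvPolynomial.aeval yB p - algebraMap R' B (MvPolynomial.constantCoeff p) ∈ J := by
    intro p
    induction p using MvPolynomial.induction_on with
    | C a =>
      rw [MvPolynomial.aeval_C, MvPolynomial.constantCoeff_C, sub_self]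
      exact J.zero_mem
    | add p q hp hq =>
      rw [map_add, map_add, map_add]
      have : MvPolynomial.aeval yB p + MvPolynomial.aeval yB q -
          (algebraMap R' B (MvPolynomial.constantCoeff p) +
            algebraMap R' B (MvPolynomial.constantCoeff q)) =
          (MvPolynomial.aeval yB p - algebraMap R' B (MvPolynomial.constantCoeff p)) +
          (MvPolynomial.aeval yB q - algebraMap R' B (MvPolynomial.constantCoeff q)) := by ring
      rw [this]
      exact J.add_mem hp hq
    | mul_X p i _ =>
      rw [map_mul, map_mul, MvPolynomial.constantCoeff_X, mul_zero, map_zero, sub_zero,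
        MvPolynomial.aeval_X]
      exact J.mul_mem_left _ (Ideal.subset_span ⟨i, rfl⟩)
  have hsurj : ∀ b : B, ∃ p : MvPolynomial (Fin d) R', MvPolynomial.aeval yB p = b := by
    intro b
    have hb : (b : E) ∈ (MvPolynomial.aeval (R := R') y).range := by
      rw [← Algebra.adjoin_range_eq_range_aeval]
      exact b.2
    obtain ⟨p, hp⟩ := hb
    refine ⟨p, Subtype.ext ?_⟩
    rw [← hp]
    change (B.val.comp (MvPolynomial.aeval yB)) p = _
    rw [MvPolynomial.comp_aeval]
    rfl
  have hQJ : Q ≤ J := by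
    intro b hb
    obtain ⟨p, rfl⟩ := hsurj b
    have h1 := haeval p
    have h2 : algebraMap R' B (MvPolynomial.constantCoeff p) ∈ Q := by
      have := Q.sub_mem hb (hJQ h1)
      rwa [sub_sub_cancel] at this
    have h3 : MvPolynomial.constantCoeff p ∈ maximalIdeal R' := by
      rw [← hcomapQ]; exact h2
    have := J.add_mem h1 (hmJ _ h3)
    rwa [sub_add_cancel] at this
  have hQeq : Q = J := le_antisymm hQJ hJQ
  -- `B` is integral over `R'`, with injective structure map
  have hyint : ∀ i, IsIntegral R' (y i) := fun i =>
    ⟨X ^ ℓ - C (z i), monic_X_pow_sub_C _ hℓ0, by simp [hy i, sub_self]⟩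
  haveI : Module.Finite R' B :=
    Algebra.finite_adjoin_of_finite_of_isIntegral (Set.finite_range y)
      (by rintro _ ⟨i, rfl⟩; exact hyint i)
  haveI : Algebra.IsIntegral R' B := Algebra.IsIntegral.of_finite R' B
  have hinjB : Function.Injective (algebraMap R' B) := fun a b hab => hinj (by
    rw [← halgB, ← halgB, hab])
  -- `B` is local with maximal ideal `Q`
  haveI hmR : (Q.comap (algebraMap R' B)).IsMaximal := by rw [hcomapQ]; infer_instance
  have hQmax : Q.IsMaximal := Ideal.isMaximal_of_isIntegral_of_isMaximal_comap Q hmR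
  have hunique : ∀ Q' : Ideal B, Q'.IsMaximal → Q' = Q := by
    intro Q' hQ'
    haveI := hQ'
    have h1 : (Q'.comap (algebraMap R' B)).IsMaximal :=
      Ideal.isMaximal_comap_of_isIntegral_of_isMaximal Q'
    have h2 : Q'.comap (algebraMap R' B) = maximalIdeal R' := IsLocalRing.eq_maximalIdeal h1
    have h3 : J ≤ Q' := by
      rw [Ideal.span_le]
      rintro _ ⟨i, rfl⟩
      have h4 : yB i ^ ℓ ∈ Q' := by
        have h5 : algebraMap R' B (z i) ∈ Q' := by
          rw [← Ideal.mem_comap, h2]; exact hzm i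
        have h6 : algebraMap R' B (z i) = yB i ^ ℓ := Subtype.ext (by rw [halgB, ← hy i]; rfl)
        rwa [h6] at h5
      exact hQ'.isPrime.mem_of_pow_mem _ h4
    rw [← hQeq] at h3
    exact (hQmax.eq_of_le hQ'.ne_top h3).symm
  haveI : IsLocalRing B := IsLocalRing.of_unique_max_ideal ⟨Q, hQmax, hunique⟩
  have hQm : maximalIdeal B = Q := (hunique _ (maximalIdeal.isMaximal B)).symm |>.symm
  -- dimensions
  have hdimB : ringKrullDim B = d := by
    rw [← Literature.RingTheory.KrullDimension.ringKrullDim_eq_of_isIntegral hinjB, hdim]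
  have hdimQ : ringKrullDim (Localization.AtPrime Q) = d := by
    rw [IsLocalization.AtPrime.ringKrullDim_eq_height Q (Localization.AtPrime Q), ← hQm,
      IsLocalRing.maximalIdeal_height_eq_ringKrullDim, hdimB]
  -- the maximal ideal of `B_Q` is generated by the `d` elements `y`
  have hmaxQ : Ideal.span (Set.range fun i => algebraMap B (Localization.AtPrime Q) (yB i)) =
      maximalIdeal (Localization.AtPrime Q) := by
    rw [← Localization.AtPrime.map_eq_maximalIdeal,
      congrArg (Ideal.map (algebraMap B (Localization.AtPrime Q))) hQeq, Ideal.map_span,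
      ← Set.range_comp]
    rfl
  refine ⟨?_, hdimQ, hmaxQ⟩
  haveI : IsNoetherianRing B :=
    isNoetherianRing_of_fg (Subalgebra.fg_def.mpr ⟨Set.range y, Set.finite_range y, rfl⟩)
  haveI : IsNoetherianRing (Localization.AtPrime Q) :=
    IsLocalization.isNoetherianRing Q.primeCompl _ inferInstance
  apply IsRegularLocalRing.of_spanFinrank_maximalIdeal_le
  rw [hdimQ, ← hmaxQ]
  have h1 : (Ideal.span (Set.range fun i => algebraMap B (Localization.AtPrime Q) (yB i))).spanFinrank
      ≤ d := by
    refine (Submodule.spanFinrank_span_le_ncard_of_finite (Set.finite_range _)).trans ?_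
    calc (Set.range fun i => algebraMap B (Localization.AtPrime Q) (yB i)).ncard
        ≤ (Finset.univ.image fun i => algebraMap B (Localization.AtPrime Q) (yB i)).card := by
          rw [← Set.ncard_coe_finset, Finset.coe_image, Finset.coe_univ, Set.image_univ]
      _ ≤ Finset.univ.card := Finset.card_image_le
      _ = d := by simp
  exact_mod_cast h1

end Roots


/-! ## The frame version: a local uniformization of `M(u^{1/ℓ}, z₁^{1/ℓ}, …, z_d^{1/ℓ})` -/

section Frame

variable {S E : Type u} [CommRing S] [IsRegularLocalRing S] [Field E] [Algebra S E]

/-- **The Kummer covering of a monomialized local uniformization** (the replacement, in this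
tree, for [CoP1] Prop. 8.3 (2): instead of resolving `X^ℓ − f` over a model in which `f` is a
monomial by the Perron transforms of Lemma 8.2, one passes to the covering obtained by adjoining
`ℓ`-th roots of the parameters and of the unit, which is regular for free, and descends
afterwards). Frame: `S` excellent regular local of dimension three in an algebraically closed
valued field `(E, O_E)` dominating it with residue field algebraic over that of `S`, `M ∋ S` a
subfield with a model `S[t] ⊆ O_E`, `t ⊆ M ⊆ Frac(S)(t)`, regular at the centre; `0 ≠ x ∈ 𝔪_v`
in the local ring of the model (`x = a₀/s₀`); `ℓ ≥ 1` with `v(ℓ) = 0`. Conclusion: finitely many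
`ρ₀, …, ρ_d ∈ E` with `ρⱼ^ℓ ∈ M` and `x = ∏ ρⱼ^{ℓ eⱼ}` (so `x` has an `ℓ`-th root in `M(ρ)`), and
a model `S[t′] ⊆ O_E` of `M(ρ)`, `t′ ⊆ M(ρ) ⊆ Frac(S)(t′)`, regular at the centre. Proof:
monomialize `x = u ∏ zᵢ^{αᵢ}` in a finer regular local ring `R′`
(`exists_localRing_monomial_of_embeddedResolution`, from the embedded-resolution hypothesis
`hEmb`), adjoin `yᵢ = zᵢ^{1/ℓ}` (`isRegularLocalRing_localization_adjoin_roots`, read on the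
`S`-model by the sandwich `S[t′] ⊆ R′[y] ⊆ S[t′]_{𝔪_v ∩ S[t′]}`), then the Hensel root
`w = u^{1/ℓ}` (`exists_model_adjoin_of_henselRoot`).
[cite: CossartPiltant2008, Prop. 6.3 (HAL Prop. 8.3 (2), pp. 23–26), proof of Lemma 9.4 (HAL p. 29)]
[cite: CossartJannsenSaito2020, Cor. 1.5, p. 7] -/
theorem exists_model_adjoin_roots_of_monomial
    (hEmb : ∀ (Z : Scheme.{u}) [IsIntegral Z] [IsNoetherian Z], Scheme.IsRegular Z →
      Scheme.IsExcellent Z → ∀ (X : Set Z), IsClosed X → X ≠ Set.univ → topologicalKrullDim X ≤ 2 →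
        ∃ (Z' : Scheme.{u}) (π : Z' ⟶ Z), IsProper π ∧ Function.Surjective π.base ∧
          (∃ U : Z.Opens, (U : Set Z) = Xᶜ ∧ IsIso (π ∣_ U)) ∧
          IsStrictNormalCrossingsDivisor Z' (π.base ⁻¹' X))
    (hS : IsExcellentRing S) (hSdim : ringKrullDim S = 3)
    (hinj : Function.Injective (algebraMap S E)) [Algebra.IsAlgebraic S E] [IsAlgClosed E]
    (OE : ValuationSubring E) (hSO : ∀ s : S, algebraMap S E s ∈ OE)
    (hdom : ∀ s ∈ maximalIdeal S, OE.valuation (algebraMap S E s) < 1)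
    (hres : ∀ y : OE, ∃ q : Polynomial S, (∃ i, q.coeff i ∉ maximalIdeal S) ∧
      OE.valuation (q.eval₂ (algebraMap S E) y) < 1)
    (M : Subfield E) (hSM : ∀ s : S, algebraMap S E s ∈ M)
    (t : Finset E) (htM : (t : Set E) ⊆ M)
    (hMcl : M ≤ Subfield.closure (Set.range (algebraMap S E) ∪ (t : Set E)))
    (hTO : (Algebra.adjoin S (t : Set E)).toSubring ≤ OE.toSubring)
    (hreg : IsRegularLocalRing (Localization.AtPrime
      (Ideal.comap (Subring.inclusion hTO) (maximalIdeal OE))))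
    (x : E) (hx0 : x ≠ 0) (hxv : OE.valuation x < 1) (a₀ s₀ : E)
    (ha₀ : a₀ ∈ Algebra.adjoin S (t : Set E)) (hs₀ : s₀ ∈ Algebra.adjoin S (t : Set E))
    (hvs₀ : OE.valuation s₀ = 1) (hxs : x * s₀ = a₀)
    {ℓ : ℕ} (hℓ : 0 < ℓ) (hvℓ : OE.valuation (ℓ : E) = 1) :
    ∃ (n : ℕ) (ρ : Fin n → E) (e : Fin n → ℕ), (∀ j, ρ j ^ ℓ ∈ M) ∧ (∀ j, ρ j ≠ 0) ∧
      x = ∏ j, ρ j ^ (ℓ * e j) ∧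
      ∃ t' : Finset E,
        (t' : Set E) ⊆ (IntermediateField.adjoin M (Set.range ρ)).toSubfield ∧
        (IntermediateField.adjoin M (Set.range ρ)).toSubfield ≤
          Subfield.closure (Set.range (algebraMap S E) ∪ (t' : Set E)) ∧
        ∃ hTO' : (Algebra.adjoin S (t' : Set E)).toSubring ≤ OE.toSubring,
          IsRegularLocalRing (Localization.AtPrime
            (Ideal.comap (Subring.inclusion hTO') (maximalIdeal OE))) := by
  classical
  haveI : IsDomain S := isDomain_of_isRegularLocalRing S
  haveI : IsNoetherianRing S := hS.isUniversallyCatenaryRing.1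
  -- the model `T₀ = S[t]`, its centre `P₀`, and the local ring `R = (T₀)_{P₀}` inside `E`
  let T₀ : Subalgebra S E := Algebra.adjoin S (t : Set E)
  let P₀ : Ideal T₀ := Ideal.comap (Subring.inclusion hTO) (maximalIdeal OE)
  haveI : P₀.IsPrime := Ideal.IsPrime.comap _
  have hP₀ : ∀ z : T₀, z ∈ P₀ ↔ OE.valuation (z : E) < 1 := fun z => by
    change Subring.inclusion hTO z ∈ maximalIdeal OE ↔ _
    rw [ValuationSubring.valuation_lt_one_iff]
    rfl
  have hT₀O : ∀ z : T₀, (z : E) ∈ OE := fun z => hTO z.2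
  have hT₀M : ∀ z : T₀, (z : E) ∈ M := fun z => by
    refine Algebra.adjoin_induction (p := fun y _ => y ∈ M) ?_ ?_ ?_ ?_ z.2
    · exact fun y hy => htM hy
    · exact hSM
    · exact fun _ _ _ _ => M.add_mem
    · exact fun _ _ _ _ => M.mul_mem
  let R : Type u := Localization.AtPrime P₀
  haveI : IsRegularLocalRing R := hreg
  haveI : IsDomain R := isDomain_of_isRegularLocalRing R
  have hunits : ∀ y : P₀.primeCompl, IsUnit (algebraMap T₀ E y) := fun y => by
    rw [isUnit_iff_ne_zero]
    intro h0
    apply y.2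
    have : (y : T₀) = 0 := Subtype.ext h0
    rw [this]
    exact P₀.zero_mem
  letI : Algebra R E := (IsLocalization.lift (M := P₀.primeCompl) hunits).toAlgebra
  haveI : IsScalarTower T₀ R E :=
    IsScalarTower.of_algebraMap_eq fun a => (IsLocalization.lift_eq hunits a).symm
  haveI : IsScalarTower S R E := IsScalarTower.of_algebraMap_eq fun s => by
    rw [IsScalarTower.algebraMap_apply S T₀ R, ← IsScalarTower.algebraMap_apply T₀ R E,
      ← IsScalarTower.algebraMap_apply S T₀ E]
  -- values of the elements of `R`
  have hval : ∀ (a : T₀) (b : P₀.primeCompl),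
      algebraMap R E (IsLocalization.mk' R a b) = (a : E) * (((b : T₀) : E))⁻¹ ∧
        OE.valuation ((b : T₀) : E) = 1 := by
    intro a b
    have hb : OE.valuation ((b : T₀) : E) = 1 := by
      have hle : OE.valuation ((b : T₀) : E) ≤ 1 := (OE.valuation_le_one_iff _).mpr (hT₀O _)
      have hnlt : ¬ OE.valuation ((b : T₀) : E) < 1 := fun hlt => b.2 ((hP₀ _).mpr hlt)
      exact le_antisymm hle (not_lt.mp hnlt)
    have hb0 : ((b : T₀) : E) ≠ 0 := fun h0 => by rw [h0, map_zero] at hb; exact zero_ne_one hb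
    refine ⟨?_, hb⟩
    have h1 := IsLocalization.mk'_spec R a b
    have h2 := congrArg (algebraMap R E) h1
    rw [map_mul, ← IsScalarTower.algebraMap_apply, ← IsScalarTower.algebraMap_apply] at h2
    have h3 : algebraMap R E (IsLocalization.mk' R a b) * ((b : T₀) : E) = (a : E) := h2
    rw [← h3, mul_inv_cancel_right₀ hb0]
  have hRO : ∀ r : R, algebraMap R E r ∈ OE := by
    intro r
    obtain ⟨⟨a, b⟩, rfl⟩ := IsLocalization.mk'_surjective P₀.primeCompl r
    obtain ⟨hab, hb⟩ := hval a b
    rw [hab]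
    refine mul_mem (hT₀O a) ?_
    rw [← OE.valuation_le_one_iff, map_inv₀, hb, inv_one]
  have hRM : ∀ r : R, algebraMap R E r ∈ M := by
    intro r
    obtain ⟨⟨a, b⟩, rfl⟩ := IsLocalization.mk'_surjective P₀.primeCompl r
    rw [(hval a b).1]
    exact M.mul_mem (hT₀M a) (M.inv_mem (hT₀M _))
  have hinjR : Function.Injective (algebraMap R E) := by
    change Function.Injective (IsLocalization.lift (M := P₀.primeCompl) hunits)
    refine (IsLocalization.lift_injective_iff _).mpr fun a b => ⟨fun h => ?_, fun h => ?_⟩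
    · rw [IsLocalization.injective R P₀.primeCompl_le_nonZeroDivisors h]
    · rw [Subtype.val_injective h]
  -- `R` is excellent of dimension three
  haveI : Algebra.FiniteType S T₀ :=
    (Subalgebra.fg_iff_finiteType _).mp (Subalgebra.fg_adjoin_finset _)
  have hexcR : IsExcellentRing R := isExcellentRing_localization_atPrime hS P₀
  haveI : FaithfulSMul S T₀ := (faithfulSMul_iff_algebraMap_injective _ _).mpr fun a b hab =>
    hinj (by
      have h1 := congrArg (fun z : T₀ => (z : E)) hab
      exact h1)
  haveI : Algebra.IsAlgebraic S T₀ :=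
    Algebra.IsAlgebraic.of_injective T₀.val Subtype.val_injective
  haveI := liesOver_maximalIdeal_of_forall_valuation_lt_one OE hSO hdom T₀ P₀ hP₀
  haveI := isAlgebraic_quotient_of_forall_valuation_lt_one OE hres T₀ hT₀O P₀ hP₀
  have hdimR : ringKrullDim R = 3 := by
    rw [← hSdim]
    exact ringKrullDim_localization_eq_of_isUniversallyCatenaryRing hS.isUniversallyCatenaryRing P₀
  -- `M` as a type: `R → ↥M → E`, `Frac R = M`, and the valuation ring `O = O_E ∩ M`
  let K : Type u := M
  letI : Algebra R K := ((algebraMap R E).codRestrict M hRM).toAlgebra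
  haveI : IsScalarTower R K E := IsScalarTower.of_algebraMap_eq fun _ => rfl
  haveI : FaithfulSMul R K := (faithfulSMul_iff_algebraMap_injective R K).mpr fun a b hab =>
    hinjR (by
      have := congrArg (fun z : K => (z : E)) hab
      exact this)
  have hT₀R : ∀ z : T₀, (algebraMap R K (algebraMap T₀ R z) : E) = (z : E) := fun z => by
    change algebraMap R E (algebraMap T₀ R z) = (z : E)
    rw [← IsScalarTower.algebraMap_apply T₀ R E]
    rfl
  haveI : IsFractionRing R K := by
    refine IsFractionRing.of_field R K fun z => ?_
    obtain ⟨a, b, ha, hb, hb0, hzab⟩ := exists_div_eq_of_mem_closure_aux' (t : Set E) (hMcl z.2)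
    refine ⟨algebraMap T₀ R ⟨a, ha⟩, algebraMap T₀ R ⟨b, hb⟩, Subtype.ext ?_⟩
    change (z : E) = ((algebraMap R K (algebraMap T₀ R ⟨a, ha⟩) / algebraMap R K (algebraMap T₀ R ⟨b, hb⟩) : K) : E)
    rw [Subfield.coe_div, hT₀R, hT₀R]
    exact hzab
  let O : ValuationSubring K := OE.comap (algebraMap K E)
  have hROK : ∀ r : R, algebraMap R K r ∈ O := fun r => hRO r
  -- the maximal ideal of `R` is cut out by `v < 1`
  have hRm : ∀ r : R, r ∈ maximalIdeal R ↔ OE.valuation (algebraMap R E r) < 1 := by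
    intro r
    obtain ⟨⟨a, b⟩, rfl⟩ := IsLocalization.mk'_surjective P₀.primeCompl r
    obtain ⟨hab, hb⟩ := hval a b
    rw [IsLocalization.AtPrime.mk'_mem_maximal_iff R P₀ a b, hab, map_mul, map_inv₀, hb, inv_one,
      mul_one, hP₀ a]
  -- `x = a₀/s₀` in `R`
  have hs₀P : (⟨s₀, hs₀⟩ : T₀) ∉ P₀ := fun h => by
    have h1 := (hP₀ _).mp h
    change OE.valuation s₀ < 1 at h1
    rw [hvs₀] at h1
    exact lt_irrefl _ h1
  let xR : R := IsLocalization.mk' R (⟨a₀, ha₀⟩ : T₀) (⟨⟨s₀, hs₀⟩, hs₀P⟩ : P₀.primeCompl)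
  have hxRE : algebraMap R E xR = x := by
    rw [(hval _ _).1]
    change a₀ * s₀⁻¹ = x
    have hs00 : s₀ ≠ 0 := fun h0 => by rw [h0, map_zero] at hvs₀; exact zero_ne_one hvs₀
    rw [← hxs, mul_inv_cancel_right₀ hs00]
  have hxR0 : xR ≠ 0 := fun h0 => hx0 (by rw [← hxRE, h0, map_zero])
  have hxRm : xR ∈ maximalIdeal R := by rw [hRm, hxRE]; exact hxv
  have hRK : Function.Injective (algebraMap R K) := FaithfulSMul.algebraMap_injective R K
  -- monomialize `x` in a finer regular local ring `R'`
  obtain ⟨uu, huuK, huuO, R', _, _, _, hinj', hR'O, hR'm, hlow, hup, d, z, α, u, hu, hdim',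
    hspan', hfact'⟩ :=
    exists_localRing_monomial_of_embeddedResolution hEmb (R := R) (K := K) (E := E) hRK hexcR
      hdimR OE hRO hRm xR hxR0 hxRm
  have hℓ0 : ℓ ≠ 0 := hℓ.ne'
  -- the roots
  have hroot : ∀ c : E, ∃ r : E, r ^ ℓ = c := fun c => IsAlgClosed.exists_pow_nat_eq c hℓ
  choose rt hrt using hroot
  let y : Fin d → E := fun i => rt (algebraMap R' E (z i))
  have hy : ∀ i, y i ^ ℓ = algebraMap R' E (z i) := fun i => hrt _
  let uE : E := algebraMap R' E u
  let w : E := rt uE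
  have hw : w ^ ℓ = uE := hrt _
  -- `uu ⊆ M`, the finer `S`-model `S[t ∪ uu]`
  have huuM : (uu : Set E) ⊆ M := by
    intro q hq
    obtain ⟨k, rfl⟩ := huuK hq
    exact k.2
  have hT₀Ruu : ∀ q : E, q ∈ Algebra.adjoin S ((T₀ : Set E) ∪ (uu : Set E)) →
      q ∈ Algebra.adjoin R (uu : Set E) := fun q hq =>
    mem_adjoin_localization_of_mem_adjoin_union T₀ R (uu : Set E) hq
  have hset : ∀ v : Set E, Algebra.adjoin S (((t ∪ uu : Finset E) : Set E) ∪ v) =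
      Algebra.adjoin S (((T₀ : Set E) ∪ (uu : Set E)) ∪ v) := by
    intro v
    rw [Finset.coe_union]
    apply le_antisymm
    · apply Algebra.adjoin_le
      rintro q ((hq | hq) | hq)
      · exact Algebra.subset_adjoin (Set.mem_union_left _ (Set.mem_union_left _
          (Algebra.subset_adjoin hq)))
      · exact Algebra.subset_adjoin (Set.mem_union_left _ (Set.mem_union_right _ hq))
      · exact Algebra.subset_adjoin (Set.mem_union_right _ hq)
    · apply Algebra.adjoin_le
      rintro q ((hq | hq) | hq)
      · exact Algebra.adjoin_mono (Set.subset_union_left.trans Set.subset_union_left) hq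
      · exact Algebra.subset_adjoin (Set.mem_union_left _ (Set.mem_union_right _ hq))
      · exact Algebra.subset_adjoin (Set.mem_union_right _ hq)
  -- elements of `R'` are fractions over `S[t ∪ uu]` with `v`-unit denominators
  have hup' : ∀ r : R', ∃ a s : E, a ∈ Algebra.adjoin S ((T₀ : Set E) ∪ (uu : Set E)) ∧
      s ∈ Algebra.adjoin S ((T₀ : Set E) ∪ (uu : Set E)) ∧ OE.valuation s = 1 ∧
      algebraMap R' E r * s = a := by
    intro r
    obtain ⟨τ, σ, hτ, hσ, hvσ, hr⟩ := hup r
    obtain ⟨a₁, s₁, ha₁, hs₁T, hs₁P, hτs⟩ :=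
      exists_mul_mem_adjoin_of_mem_adjoin_localization T₀ P₀ R (uu : Set E) τ hτ
    obtain ⟨a₂, s₂, ha₂, hs₂T, hs₂P, hσs⟩ :=
      exists_mul_mem_adjoin_of_mem_adjoin_localization T₀ P₀ R (uu : Set E) σ hσ
    have hvs : ∀ s : E, ∀ hs : s ∈ T₀, (⟨s, hs⟩ : T₀) ∉ P₀ → OE.valuation s = 1 := fun s hs hsP => by
      have hle : OE.valuation s ≤ 1 := (OE.valuation_le_one_iff _).mpr (hT₀O ⟨s, hs⟩)
      have hnlt : ¬ OE.valuation s < 1 := fun hlt => hsP ((hP₀ ⟨s, hs⟩).mpr hlt)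
      exact le_antisymm hle (not_lt.mp hnlt)
    have hT₀sub : ∀ s : E, s ∈ T₀ → s ∈ Algebra.adjoin S ((T₀ : Set E) ∪ (uu : Set E)) :=
      fun s hs => Algebra.subset_adjoin (Set.mem_union_left _ hs)
    refine ⟨a₁ * s₂, a₂ * s₁, mul_mem ha₁ (hT₀sub _ hs₂T), mul_mem ha₂ (hT₀sub _ hs₁T), ?_, ?_⟩
    · have h1 : OE.valuation a₂ = 1 := by
        rw [← hσs, map_mul, hvσ, hvs s₂ hs₂T (hs₂P hs₂T), one_mul]
      rw [map_mul, h1, hvs s₁ hs₁T (hs₁P hs₁T), one_mul]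
    · calc algebraMap R' E r * (a₂ * s₁) = (algebraMap R' E r * σ) * s₁ * s₂ := by
            rw [← hσs]; ring
        _ = a₁ * s₂ := by rw [hr, hτs]
  /- the model upstairs: `B = R'[y]`, regular at the centre -/
  let B : Subalgebra R' E := Algebra.adjoin R' (Set.range y)
  have hyO : ∀ i, y i ∈ OE := fun i => by
    have h1 : OE.valuation (y i) ≤ 1 := by
      by_contra h
      have h2 : 1 < OE.valuation (y i) := not_le.mp h
      have h3 : 1 < OE.valuation (y i ^ ℓ) := by
        rw [map_pow]; exact one_lt_pow₀ h2 hℓ0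
      rw [hy i] at h3
      exact not_le.mpr h3 ((OE.valuation_le_one_iff _).mpr (hR'O _))
    exact (OE.valuation_le_one_iff _).mp h1
  have hBO' : ∀ b : B, (b : E) ∈ OE := by
    intro b
    refine Algebra.adjoin_induction (p := fun b _ => b ∈ OE) ?_ ?_ ?_ ?_ b.2
    · rintro _ ⟨i, rfl⟩; exact hyO i
    · exact hR'O
    · exact fun _ _ _ _ => OE.add_mem _ _
    · exact fun _ _ _ _ => OE.mul_mem _ _
  have hBO : B.toSubring ≤ OE.toSubring := fun b hb => hBO' ⟨b, hb⟩
  let Q : Ideal B := Ideal.comap (Subring.inclusion hBO) (maximalIdeal OE)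
  haveI : Q.IsPrime := Ideal.IsPrime.comap _
  have hQ : ∀ b : B, b ∈ Q ↔ OE.valuation (b : E) < 1 := fun b => by
    change Subring.inclusion hBO b ∈ maximalIdeal OE ↔ _
    rw [ValuationSubring.valuation_lt_one_iff]
    rfl
  obtain ⟨hregQ, -, -⟩ := isRegularLocalRing_localization_adjoin_roots OE hinj' hR'O hR'm z hspan'
    hdim' hℓ y hy Q hQ
  /- the `S`-model `S[t ∪ uu ∪ y]` has the same local ring (sandwich) -/
  let t₁ : Finset E := (t ∪ uu) ∪ Finset.univ.image y
  let A₁ : Subalgebra S E := Algebra.adjoin S (t₁ : Set E)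
  have hA₁eq : A₁ = Algebra.adjoin S (((T₀ : Set E) ∪ (uu : Set E)) ∪ Set.range y) := by
    change Algebra.adjoin S (((t ∪ uu) ∪ Finset.univ.image y : Finset E) : Set E) = _
    rw [Finset.coe_union (t ∪ uu), Finset.coe_image, Finset.coe_univ, Set.image_univ]
    exact hset _
  have hlowS : ∀ q : E, q ∈ Algebra.adjoin S ((T₀ : Set E) ∪ (uu : Set E)) → q ∈ B := by
    intro q hq
    obtain ⟨r, rfl⟩ := hlow q (hT₀Ruu q hq)
    exact B.algebraMap_mem r
  have hA₁B : ∀ q : E, q ∈ A₁ → q ∈ B := by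
    intro q hq
    rw [hA₁eq] at hq
    refine Algebra.adjoin_induction (p := fun q _ => q ∈ B) ?_ ?_ ?_ ?_ hq
    · rintro q (hq | ⟨i, rfl⟩)
      · exact hlowS q (Algebra.subset_adjoin hq)
      · exact Algebra.subset_adjoin ⟨i, rfl⟩
    · intro s
      exact hlowS _ (Subalgebra.algebraMap_mem _ s)
    · exact fun _ _ _ _ => B.add_mem
    · exact fun _ _ _ _ => B.mul_mem
  let f : A₁ →+* B :=
    { toFun := fun a => ⟨a, hA₁B a a.2⟩
      map_one' := Subtype.ext rfl
      map_mul' := fun _ _ => Subtype.ext rfl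
      map_zero' := Subtype.ext rfl
      map_add' := fun _ _ => Subtype.ext rfl }
  have hf : ∀ a : A₁, ((f a : B) : E) = (a : E) := fun _ => rfl
  have hfinj : Function.Injective f := fun a b hab => Subtype.ext (by
    rw [← hf a, ← hf b, hab])
  have hA₁low : ∀ q : E, q ∈ Algebra.adjoin S ((T₀ : Set E) ∪ (uu : Set E)) → q ∈ A₁ := by
    intro q hq
    rw [hA₁eq]
    exact Algebra.adjoin_mono Set.subset_union_left hq
  have Hfrac : ∀ b : B, ∃ a s : E, a ∈ A₁ ∧ s ∈ A₁ ∧ OE.valuation s = 1 ∧ (b : E) * s = a := by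
    intro b
    refine Algebra.adjoin_induction (p := fun b _ => ∃ a s : E, a ∈ A₁ ∧ s ∈ A₁ ∧
        OE.valuation s = 1 ∧ b * s = a) ?_ ?_ ?_ ?_ b.2
    · rintro _ ⟨i, rfl⟩
      refine ⟨y i, 1, Algebra.subset_adjoin ?_, one_mem _, map_one _, mul_one _⟩
      simp [t₁]
    · intro r
      obtain ⟨a, s', ha, hs', hvs', hr⟩ := hup' r
      exact ⟨a, s', hA₁low a ha, hA₁low s' hs', hvs', hr⟩
    · rintro p q - - ⟨a₁, s₁, ha₁, hs₁, hv₁, h₁⟩ ⟨a₂, s₂, ha₂, hs₂, hv₂, h₂⟩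
      refine ⟨a₁ * s₂ + a₂ * s₁, s₁ * s₂, add_mem (mul_mem ha₁ hs₂) (mul_mem ha₂ hs₁),
        mul_mem hs₁ hs₂, by rw [map_mul, hv₁, hv₂, one_mul], ?_⟩
      rw [← h₁, ← h₂]; ring
    · rintro p q - - ⟨a₁, s₁, ha₁, hs₁, hv₁, h₁⟩ ⟨a₂, s₂, ha₂, hs₂, hv₂, h₂⟩
      refine ⟨a₁ * a₂, s₁ * s₂, mul_mem ha₁ ha₂, mul_mem hs₁ hs₂,
        by rw [map_mul, hv₁, hv₂, one_mul], ?_⟩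
      rw [← h₁, ← h₂]; ring
  have H : ∀ b : B, ∃ a s : A₁, f s ∉ Q ∧ b * f s = f a := by
    intro b
    obtain ⟨a, s', ha, hs', hvs', hb⟩ := Hfrac b
    refine ⟨⟨a, ha⟩, ⟨s', hs'⟩, fun h => ?_, Subtype.ext hb⟩
    have h1 := (hQ _).mp h
    rw [hf] at h1
    change OE.valuation s' < 1 at h1
    rw [hvs'] at h1
    exact lt_irrefl _ h1
  have hregc : IsRegularLocalRing (Localization.AtPrime (Q.comap f)) :=
    (isRegularLocalRing_localization_comap_iff_of_sandwich f hfinj Q H).mpr hregQ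
  have hA₁O : A₁.toSubring ≤ OE.toSubring := fun a ha => hBO' ⟨a, hA₁B a ha⟩
  let P₁ : Ideal A₁ := Ideal.comap (Subring.inclusion hA₁O) (maximalIdeal OE)
  haveI : P₁.IsPrime := Ideal.IsPrime.comap _
  have hP₁ : ∀ a : A₁, a ∈ P₁ ↔ OE.valuation (a : E) < 1 := fun a => by
    change Subring.inclusion hA₁O a ∈ maximalIdeal OE ↔ _
    rw [ValuationSubring.valuation_lt_one_iff]
    rfl
  haveI : (Q.comap f).IsPrime := Ideal.IsPrime.comap _
  have hQf : ∀ a : A₁, a ∈ Q.comap f ↔ OE.valuation (a : E) < 1 := fun a => by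
    rw [Ideal.mem_comap, hQ, hf]
  have hPeq : Q.comap f = P₁ := by
    ext a
    rw [hQf, hP₁]
  have key : ∀ (P P' : Ideal A₁) [P.IsPrime] [P'.IsPrime], P = P' →
      IsRegularLocalRing (Localization.AtPrime P) → IsRegularLocalRing (Localization.AtPrime P') := by
    intro P P' _ _ h hP
    subst h
    exact hP
  have hreg₁ : IsRegularLocalRing (Localization.AtPrime P₁) := key _ _ hPeq hregc
  /- the Hensel root `w = u^{1/ℓ}` over the model `S[t₁]` of `M₁ = Frac(S)(t₁)` -/
  let M₁ : Subfield E := Subfield.closure (Set.range (algebraMap S E) ∪ (t₁ : Set E))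
  have ht₁M₁ : (t₁ : Set E) ⊆ M₁ := fun q hq => Subfield.subset_closure (Or.inr hq)
  have hvR' : ∀ r : R', OE.valuation (algebraMap R' E r) ≤ 1 := fun r =>
    (OE.valuation_le_one_iff _).mpr (hR'O r)
  have hvuE : OE.valuation uE = 1 := by
    have hnlt : ¬ OE.valuation uE < 1 := fun hlt =>
      (IsLocalRing.mem_maximalIdeal _).mp ((hR'm u).mpr hlt) hu
    exact le_antisymm (hvR' u) (not_lt.mp hnlt)
  have hvw : OE.valuation w = 1 := by
    have h1 : OE.valuation w ^ ℓ = 1 := by rw [← map_pow, hw, hvuE]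
    rcases pow_eq_one_iff.mp h1 with h2 | h2
    · exact h2
    · exact absurd h2 hℓ0
  have hwO : w ∈ OE := (OE.valuation_le_one_iff _).mp hvw.le
  let F : Polynomial E := X ^ ℓ - C uE
  have hFmon : F.Monic := monic_X_pow_sub_C uE hℓ0
  have hFw : F.eval w = 0 := by
    simp only [F, eval_sub, eval_pow, eval_X, eval_C, hw, sub_self]
  have hF' : OE.valuation ((derivative F).eval w) = 1 := by
    have h1 : (derivative F).eval w = (ℓ : E) * w ^ (ℓ - 1) := by
      simp only [F, derivative_sub, derivative_X_pow, derivative_C, sub_zero, eval_mul,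
        eval_pow, eval_X, map_natCast, eval_natCast]
    rw [h1, map_mul, map_pow, hvℓ, hvw, one_pow, one_mul]
  obtain ⟨aU, sU, haU, hsU, hvsU, huU⟩ := hup' u
  have hcoef : ∀ i, ∃ a s' : E, a ∈ Algebra.adjoin S (t₁ : Set E) ∧
      s' ∈ Algebra.adjoin S (t₁ : Set E) ∧ OE.valuation s' = 1 ∧ F.coeff i * s' = a := by
    intro i
    have hcoeff : F.coeff i = (if i = ℓ then 1 else 0) - (if i = 0 then uE else 0) := by
      simp only [F, coeff_sub, coeff_X_pow, coeff_C]
    by_cases hi0 : i = 0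
    · subst hi0
      refine ⟨-aU, sU, A₁.neg_mem (hA₁low _ haU), hA₁low _ hsU, hvsU, ?_⟩
      rw [hcoeff, if_neg (Ne.symm hℓ0), if_pos rfl, zero_sub, neg_mul]
      exact congrArg Neg.neg huU
    · by_cases hiℓ : i = ℓ
      · refine ⟨1, 1, one_mem _, one_mem _, map_one _, ?_⟩
        rw [hcoeff, if_pos hiℓ, if_neg hi0, sub_zero, one_mul]
      · refine ⟨0, 1, zero_mem _, one_mem _, map_one _, ?_⟩
        rw [hcoeff, if_neg hiℓ, if_neg hi0, sub_zero, zero_mul]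
  obtain ⟨t', ht'N, hNcl, hTO', hreg'⟩ := exists_model_adjoin_of_henselRoot OE M₁ t₁ ht₁M₁ le_rfl
    hA₁O hreg₁ w hwO F hFmon hFw hF' hcoef
  /- assembly -/
  have hT₀uuM : ∀ q : E, q ∈ Algebra.adjoin S ((T₀ : Set E) ∪ (uu : Set E)) → q ∈ M := by
    intro q hq
    refine Algebra.adjoin_induction (p := fun q _ => q ∈ M) ?_ ?_ ?_ ?_ hq
    · rintro q (hq | hq)
      · exact hT₀M ⟨q, hq⟩
      · exact huuM hq
    · exact hSM
    · exact fun _ _ _ _ => M.add_mem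
    · exact fun _ _ _ _ => M.mul_mem
  have hR'M : ∀ r : R', algebraMap R' E r ∈ M := by
    intro r
    obtain ⟨a, s', ha, hs', hvs', hr⟩ := hup' r
    have hs0 : s' ≠ 0 := fun h0 => by rw [h0, map_zero] at hvs'; exact zero_ne_one hvs'
    have : algebraMap R' E r = a / s' := by rw [← hr, mul_div_cancel_right₀ _ hs0]
    rw [this]
    exact M.div_mem (hT₀uuM a ha) (hT₀uuM s' hs')
  let ρ : Fin (d + 1) → E := Fin.cons w y
  let e : Fin (d + 1) → ℕ := Fin.cons 1 α
  have hρ0 : ρ 0 = w := rfl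
  have hρs : ∀ i, ρ i.succ = y i := fun i => by simp [ρ]
  have he0 : e 0 = 1 := rfl
  have hes : ∀ i, e i.succ = α i := fun i => by simp [e]
  -- the subfield `M(ρ) = M₁(w)`
  have hMM₁ : (M : Set E) ⊆ M₁ := fun q hq => Subfield.closure_mono
    (Set.union_subset_union_right _ (by
      intro q hq; simp only [t₁, Finset.coe_union]; exact Or.inl (Or.inl hq))) (hMcl hq)
  have hNeq : (IntermediateField.adjoin M (Set.range ρ)).toSubfield =
      (IntermediateField.adjoin M₁ ({w} : Set E)).toSubfield := by
    change Subfield.closure (Set.range (algebraMap M E) ∪ Set.range ρ) =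
      Subfield.closure (Set.range (algebraMap M₁ E) ∪ {w})
    have hrM : Set.range (algebraMap M E) = (M : Set E) := Subtype.range_coe
    have hrM₁ : Set.range (algebraMap M₁ E) = (M₁ : Set E) := Subtype.range_coe
    rw [hrM, hrM₁]
    apply le_antisymm
    · rw [Subfield.closure_le]
      rintro q (hq | ⟨j, rfl⟩)
      · exact Subfield.subset_closure (Or.inl (hMM₁ hq))
      · refine Fin.cases ?_ (fun i => ?_) j
        · exact Subfield.subset_closure (Or.inr rfl)
        · rw [hρs]
          refine Subfield.subset_closure (Or.inl (ht₁M₁ ?_))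
          simp [t₁]
    · rw [Subfield.closure_le]
      rintro q (hq | hq)
      · refine (Subfield.closure_le.mpr ?_) hq
        rintro q (⟨s', rfl⟩ | hq)
        · exact Subfield.subset_closure (Or.inl (hSM s'))
        · have hq' : q ∈ t ∨ q ∈ uu ∨ ∃ i, y i = q := by
            simpa [t₁, Finset.coe_union] using hq
          rcases hq' with hq' | hq' | ⟨i, rfl⟩
          · exact Subfield.subset_closure (Or.inl (htM hq'))
          · exact Subfield.subset_closure (Or.inl (huuM hq'))
          · rw [← hρs]
            exact Subfield.subset_closure (Or.inr ⟨_, rfl⟩)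
      · rw [Set.mem_singleton_iff.mp hq, ← hρ0]
        exact Subfield.subset_closure (Or.inr ⟨0, rfl⟩)
  -- the roots are non-zero
  have hz0 : ∀ i, z i ≠ 0 := by
    intro i h0
    have hreg' := (isRegularLocalRing_iff R').mp inferInstance
    have hs : Ideal.span ((Finset.univ.image z : Finset R') : Set R') = maximalIdeal R' := by
      rw [Finset.coe_image, Finset.coe_univ, Set.image_univ, hspan']
    have hcard : (Finset.univ.image z).card ≤ (maximalIdeal R').spanFinrank := by
      have h1 : ((maximalIdeal R').spanFinrank : WithBot ℕ∞) = d := by rw [hreg', hdim']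
      have h2 : (maximalIdeal R').spanFinrank = d := by exact_mod_cast h1
      rw [h2]
      exact Finset.card_image_le.trans (by simp)
    have h3 := not_mem_sq_of_span_eq_maximalIdeal _ hs hcard (Finset.mem_image_of_mem z (Finset.mem_univ i))
    rw [h0] at h3
    exact h3 (Ideal.zero_mem _)
  have hw0 : w ≠ 0 := fun h0 => by rw [h0, map_zero] at hvw; exact zero_ne_one hvw
  have hy0 : ∀ i, y i ≠ 0 := fun i h0 => by
    have h1 := hy i
    rw [h0, zero_pow hℓ0] at h1
    exact hz0 i (hinj' (by rw [map_zero]; exact h1.symm))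
  refine ⟨d + 1, ρ, e, ?_, ?_, ?_, t', ?_, ?_, hTO', hreg'⟩
  · intro j
    refine Fin.cases ?_ (fun i => ?_) j
    · rw [hρ0, hw]; exact hR'M u
    · rw [hρs, hy]; exact hR'M _
  · intro j
    refine Fin.cases ?_ (fun i => ?_) j
    · rw [hρ0]; exact hw0
    · rw [hρs]; exact hy0 i
  · rw [Fin.prod_univ_succ, hρ0, he0, mul_one, hw]
    simp only [hρs, hes]
    have h1 : ∀ i, y i ^ (ℓ * α i) = algebraMap R' E (z i) ^ α i := fun i => by
      rw [pow_mul, hy]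
    simp only [h1]
    rw [← hxRE, hfact', map_mul, map_prod]
    simp only [map_pow]
    rfl
  · rw [hNeq]; exact ht'N
  · rw [hNeq]; exact hNcl

end Frame

end Literature.AlgebraicGeometry.Resolution

end
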